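import Mathlib
import HarnessLib

/-!
# Two-colourability and odd cycles (König; Diestel Prop. 1.6.1)

Source. R. Diestel, *Graph Theory*, 4th ed., GTM 173, Springer 2010 [Diestel2010], §1.6,
Proposition 1.6.1 (held text `book:diestel2010-graph-theory`, p18): "A graph is bipartite if and
only if it contains no odd cycle." (The printed proof 2-colours each component by the parity of the
tree path from a root and finds an odd cycle when an edge joins two vertices of equal parity.)

We state it for finite simple graphs in the elementary vocabulary used by the cp-graph files
(`Literature/Combinatorics/Optimization/CompletelyPositiveGraphs.lean`): a 2-colouring is a map
`c : ι → Bool` with `G.Adj u v → c u ≠ c v`, and "contains an odd cycle of length `2n+3`" is an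
injective `f : Fin (2n+3) → ι` with `G.Adj (f a) (f (a+1))` for all `a` (indices mod `2n+3`).

Contents.
* PROVED `exists_oddCycle_of_not_twoColourable` — the nontrivial direction: a finite graph with no
  2-colouring contains an odd cycle (parity of the distance from a representative of the component
  gives a colouring unless some edge closes an odd closed walk; a shortest odd closed walk is a
  cycle).
* PROVED `not_twoColourable_of_oddCycle` — the easy direction.
* PROVED `exists_triangle_of_not_twoColourable` — if moreover `G` has no odd cycle of length `≥ 5`
  (the hypothesis of the Kogan–Berman cp-graph theorem), it contains a triangle.
-/

namespace Literature.Combinatorics.SimpleGraph.BipartiteOddCycle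

open SimpleGraph

variable {ι : Type} [Fintype ι]

omit [Fintype ι] in
/-- A closed walk of minimal odd length visits no vertex twice. [folklore] -/
private theorem getVert_injOn_of_minimal {G : SimpleGraph ι} {x : ι} (w : G.Walk x x)
    (hmin : ∀ (y : ι) (w' : G.Walk y y), w'.length % 2 = 1 → w.length ≤ w'.length)
    (hodd : w.length % 2 = 1) :
    ∀ i j : ℕ, i < j → j < w.length → w.getVert i ≠ w.getVert j := by
  intro i j hij hjm heq
  -- split `w` at the two visits of `y = w.getVert i = w.getVert j`
  have hdl : (w.drop i).length = w.length - i := w.drop_length i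
  have hB : ((w.drop i).take (j - i)).length = j - i := by
    rw [SimpleGraph.Walk.take_length, hdl]
    omega
  have hBend : (w.drop i).getVert (j - i) = w.getVert i := by
    rw [SimpleGraph.Walk.drop_getVert, heq]
    congr 1
    omega
  -- the middle piece: a closed walk at `w.getVert i` of length `j - i`
  let B : G.Walk (w.getVert i) (w.getVert i) := ((w.drop i).take (j - i)).copy rfl hBend
  have hBlen : B.length = j - i := by
    simp only [B, SimpleGraph.Walk.length_copy, hB]
  -- the outer piece: a closed walk at `x` of length `i + (m - j)`
  let C : G.Walk x x := (w.take i).append ((w.drop j).copy heq.symm rfl)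
  have hClen : C.length = i + (w.length - j) := by
    simp only [C, SimpleGraph.Walk.length_append, SimpleGraph.Walk.take_length,
      SimpleGraph.Walk.length_copy, SimpleGraph.Walk.drop_length]
    omega
  -- one of them is odd and shorter
  rcases Nat.even_or_odd (j - i) with hev | hod
  · have hCodd : C.length % 2 = 1 := by
      rw [hClen]
      rcases hev with ⟨r, hr⟩
      omega
    have := hmin x C hCodd
    rw [hClen] at this
    omega
  · have hBodd : B.length % 2 = 1 := by
      rw [hBlen]
      rcases hod with ⟨r, hr⟩
      omega
    have := hmin _ B hBodd
    rw [hBlen] at this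
    omega

/-- **No 2-colouring ⇒ an odd cycle** ([Diestel2010] Prop. 1.6.1, the direction "no odd cycle ⇒
bipartite", contrapositive, for finite graphs): if `G` admits no map `c : ι → Bool` separating
adjacent vertices then `G` contains an odd cycle, i.e. an injective `f : Fin (2n+3) → ι` with
`f a ∼ f (a+1)` for all `a`. [cite: Diestel2010, Proposition 1.6.1 (p18)] -/
theorem exists_oddCycle_of_not_twoColourable (G : SimpleGraph ι)
    (h : ¬ ∃ c : ι → Bool, ∀ u v, G.Adj u v → c u ≠ c v) :
    ∃ (n : ℕ) (f : Fin (2 * n + 3) → ι), Function.Injective f ∧ ∀ a, G.Adj (f a) (f (a + 1)) := by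
  classical
  -- Step 1: an odd closed walk, from the parity-of-distance colouring of each component
  obtain ⟨root, hroot⟩ : ∃ root : ι → ι, ∀ v, G.connectedComponentMk (root v) = G.connectedComponentMk v ∧
      ∀ u, G.Reachable u v → root u = root v := by
    refine ⟨fun v => (G.connectedComponentMk v).out, fun v => ⟨Quot.out_eq _, fun u huv => ?_⟩⟩
    show (G.connectedComponentMk u).out = (G.connectedComponentMk v).out
    rw [SimpleGraph.ConnectedComponent.sound huv]
  have hP : ∃ m : ℕ, m % 2 = 1 ∧ ∃ (x : ι) (w : G.Walk x x), w.length = m := by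
    by_contra hno
    apply h
    refine ⟨fun v => decide (G.dist (root v) v % 2 = 1), fun u v huv heq => ?_⟩
    have hr : root u = root v := (hroot v).2 u huv.reachable
    have hru : G.Reachable (root v) u := by
      rw [← hr]; exact SimpleGraph.ConnectedComponent.exact (hroot u).1
    have hrv : G.Reachable (root v) v := SimpleGraph.ConnectedComponent.exact (hroot v).1
    obtain ⟨p, hp⟩ := hru.exists_walk_length_eq_dist
    obtain ⟨q, hq⟩ := hrv.exists_walk_length_eq_dist
    have hiff : (G.dist (root v) u % 2 = 1) ↔ (G.dist (root v) v % 2 = 1) := by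
      dsimp only at heq
      rw [hr] at heq
      exact decide_eq_decide.mp heq
    -- the closed walk root → u → v → root has odd length
    let W : G.Walk (root v) (root v) := p.append (SimpleGraph.Walk.cons huv q.reverse)
    have hW : W.length = G.dist (root v) u + (G.dist (root v) v + 1) := by
      simp only [W, SimpleGraph.Walk.length_append, SimpleGraph.Walk.length_cons,
        SimpleGraph.Walk.length_reverse, hp, hq]
    apply hno
    refine ⟨W.length, ?_, root v, W, rfl⟩
    rw [hW]
    rcases Nat.mod_two_eq_zero_or_one (G.dist (root v) u) with hu | hu <;>
      rcases Nat.mod_two_eq_zero_or_one (G.dist (root v) v) with hv | hv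
    · omega
    · exact absurd (hiff.2 hv) (by omega)
    · exact absurd (hiff.1 hu) (by omega)
    · omega
  -- Step 2: a shortest odd closed walk is a cycle of length `2n + 3`
  obtain ⟨hodd, x, w, hwlen⟩ := Nat.find_spec hP
  have hmin : ∀ (y : ι) (w' : G.Walk y y), w'.length % 2 = 1 → w.length ≤ w'.length := by
    intro y w' hw'
    rw [hwlen]
    exact Nat.find_min' hP ⟨hw', y, w', rfl⟩
  rw [← hwlen] at hodd
  have h3 : 3 ≤ w.length := by
    by_contra hlt
    have h1 : w.length = 1 := by omega
    have hadj := w.adj_getVert_succ (i := 0) (by omega)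
    rw [SimpleGraph.Walk.getVert_zero, zero_add, ← h1, SimpleGraph.Walk.getVert_length] at hadj
    exact G.irrefl hadj
  obtain ⟨n, hn⟩ : ∃ n : ℕ, w.length = 2 * n + 3 := ⟨(w.length - 3) / 2, by omega⟩
  have hinj := getVert_injOn_of_minimal w hmin hodd
  refine ⟨n, fun a => w.getVert a, fun a b hab => ?_, fun a => ?_⟩
  · by_contra hne
    rcases lt_or_gt_of_ne (fun h' : (a : ℕ) = b => hne (Fin.ext h')) with hlt | hlt
    · exact hinj a b hlt (by omega) hab
    · exact hinj b a hlt (by omega) hab.symm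
  · have hadj := w.adj_getVert_succ (i := a) (by omega)
    have hval : ((a + 1 : Fin (2 * n + 3)) : ℕ) = if 2 * n + 3 ≤ (a : ℕ) + 1 then (a : ℕ) + 1 - (2 * n + 3)
        else (a : ℕ) + 1 := by
      rw [Fin.val_add_eq_ite]
      simp
    by_cases hlast : 2 * n + 3 ≤ (a : ℕ) + 1
    · rw [if_pos hlast] at hval
      have h0 : ((a + 1 : Fin (2 * n + 3)) : ℕ) = 0 := by omega
      have hlen : (a : ℕ) + 1 = w.length := by omega
      dsimp only
      rw [h0, SimpleGraph.Walk.getVert_zero]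
      rw [hlen, SimpleGraph.Walk.getVert_length] at hadj
      exact hadj
    · rw [if_neg hlast] at hval
      dsimp only
      rw [hval]
      exact hadj

omit [Fintype ι] in
/-- The easy direction of [Diestel2010] Prop. 1.6.1: an odd cycle admits no 2-colouring (the colour
would have to alternate around a cycle of odd length; we count: `a ↦ a + 1` maps each colour class
of the cycle injectively into the other). [cite: Diestel2010, Proposition 1.6.1 (p18)] -/
theorem not_twoColourable_of_oddCycle (G : SimpleGraph ι) {n : ℕ} (f : Fin (2 * n + 3) → ι)
    (hf : ∀ a, G.Adj (f a) (f (a + 1))) : ¬ ∃ c : ι → Bool, ∀ u v, G.Adj u v → c u ≠ c v := by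
  rintro ⟨c, hc⟩
  have hflip : ∀ a, c (f (a + 1)) = !c (f a) := by
    intro a
    have h := hc _ _ (hf a)
    cases h1 : c (f a) <;> cases h2 : c (f (a + 1)) <;> simp_all
  have hcount := Finset.card_filter_add_card_filter_not
    (s := (Finset.univ : Finset (Fin (2 * n + 3)))) (fun a => c (f a) = true)
  rw [Finset.card_univ, Fintype.card_fin] at hcount
  have h1 : (Finset.univ.filter fun a : Fin (2 * n + 3) => c (f a) = true).card ≤
      (Finset.univ.filter fun a : Fin (2 * n + 3) => ¬ c (f a) = true).card := by
    refine Finset.card_le_card_of_injOn (fun a => a + 1) (fun a ha => ?_) fun a _ b _ hab => ?_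
    · simp only [Finset.coe_filter, Finset.mem_univ, true_and, Set.mem_setOf_eq] at ha ⊢
      rw [hflip, ha]
      decide
    · exact add_right_cancel hab
  have h2 : (Finset.univ.filter fun a : Fin (2 * n + 3) => ¬ c (f a) = true).card ≤
      (Finset.univ.filter fun a : Fin (2 * n + 3) => c (f a) = true).card := by
    refine Finset.card_le_card_of_injOn (fun a => a + 1) (fun a ha => ?_) fun a _ b _ hab => ?_
    · simp only [Finset.coe_filter, Finset.mem_univ, true_and, Set.mem_setOf_eq,
        Bool.not_eq_true] at ha ⊢
      rw [hflip, ha]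
      decide
    · exact add_right_cancel hab
  omega

/-- If a finite graph has no 2-colouring and no odd cycle of length `≥ 5` (the hypothesis
"does not contain an odd cycle of length greater than 4" of the Kogan–Berman cp-graph theorem,
`Literature.Combinatorics.Optimization.KoganBerman1993`), then it contains a triangle.
[cite: Diestel2010, Proposition 1.6.1 (p18)] -/
theorem exists_triangle_of_not_twoColourable (G : SimpleGraph ι)
    (h : ¬ ∃ c : ι → Bool, ∀ u v, G.Adj u v → c u ≠ c v)
    (hno : ¬ ∃ (s : ℕ) (f : Fin (2 * s + 5) → ι), Function.Injective f ∧ ∀ a, G.Adj (f a) (f (a + 1))) :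
    ∃ x y z : ι, G.Adj x y ∧ G.Adj y z ∧ G.Adj z x := by
  obtain ⟨n, f, hf, hadj⟩ := exists_oddCycle_of_not_twoColourable G h
  cases n with
  | zero =>
    refine ⟨f 0, f 1, f 2, hadj 0, hadj 1, ?_⟩
    have := hadj 2
    simpa using this
  | succ k =>
    exfalso
    have e : 2 * k + 5 = 2 * (k + 1) + 3 := by ring
    refine hno ⟨k, fun a => f (Fin.cast e a), fun a b hab => Fin.cast_injective e (hf hab), fun a => ?_⟩
    have hc : Fin.cast e (a + 1) = Fin.cast e a + 1 := by
      apply Fin.ext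
      rw [Fin.val_cast, Fin.val_add_eq_ite, Fin.val_add_eq_ite, Fin.val_cast]
      simp only [Fin.val_one', Nat.one_mod_eq_one.mpr (by omega : 2 * k + 5 ≠ 1),
        Nat.one_mod_eq_one.mpr (by omega : 2 * (k + 1) + 3 ≠ 1)]
      split_ifs <;> omega
    have := hadj (Fin.cast e a)
    rwa [← hc] at this

end Literature.Combinatorics.SimpleGraph.BipartiteOddCycle
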